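import Literature.AlgebraicGeometry.ShimuraVarieties.UnitaryShimuraCurveHeckeDescent
import Literature.AlgebraicGeometry.ShimuraVarieties.UnitaryGroupFrameTwistTransport
import Literature.AlgebraicGeometry.ShimuraVarieties.UnitaryShimuraCanonicalModelComplexFibre
import Literature.AlgebraicGeometry.ShimuraVarieties.UnitaryShimuraCanonicalModelNonVacuity
import HarnessLib

/-!
# The EMBEDDING `Sh(U(J⋆), 𝔻) → Sh(U(H), 𝔹²)` of canonical models descends to the reflex field once it is a morphism
# over `ℂ` ([Deligne 1979] 2.2.6 / [Milne 2005] Thm. 13.7–Rem. 13.8 by the printed Prop.-13.1 + Lemma-13.5 argument)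

Topic `AlgebraicGeometry/ShimuraVarieties`, namespace `…ShimuraVarieties.UnitaryCanonicalModel`. THEOREMS ONLY (no
definition, no named fact, no `sorry`).  SOURCE = the curve record system ★ `RecordSystemGS L J⋆ τ K₀⋆` (`U(J⋆)`),
TARGET = the rank-3 record system ★ `RecordSystem L H τ T hT K₀` (`U(H)`), along the sub-datum `φGS = R_B ∘ (· ⊕ 1)`
of a frame `ᵗ(cB)·(a·H)·B = J⋆ ⊕ J⊥` ([Liu2021] Thm. 4.15, «the morphism `Sh(G⋆, h⋆) → Sh(G, h)` over `E`»).

**If the sub-ball inclusion `[v, uK⋆] ↦ [𝔹(B^τ(v ⊕ 0)), φGS(u)K]` (★ `ShimuraSetGS.embPoints`) is the map on complex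
points of SOME morphism `ι_ℂ : (M⋆_{K⋆})_τ → (M_K)_τ` of the complex fibres over `ℂ`, then ★ GS-2b's
`S⋆.IsEmbedding S … K⋆ K hK ι` holds for some `L`-morphism `ι : M⋆_{K⋆} → M_K`**
(`RecordSystemGS.exists_embedding_of_complex`); whence `RecordSystemGS.embeddingDefinedOver_of_complex`: the conjunct
u2 `S⋆.EmbeddingDefinedOver S …` of the named fact ★ `exists_recordSystemGS` follows from its COMPLEX half alone.
The proof is that of ★ `UnitaryShimuraCurveHeckeDescent` with two records: `σ(ι_ℂ) = ι_ℂ` on the Hecke orbit of a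
special point `[τw]` of the SOURCE (`w ∈ L²` negative at `τ`), whose image is the special point of the `L`-line of
`v₃ = B·(w ⊕ 0)` of the TARGET (`embPoints_mk_of_isLinePoint`) — the source's `recip` with the twists `d⋆, d⋆'`, the
target's `recip` with the TRANSPORTED twists `φGS(d⋆), φGS(d⋆')` (★ `isDiagTwist_φGS_of_isDiagTwistGS`,
`UnitaryGroupFrameTwistTransport`) — then density of that orbit in `Sh_{K⋆}(ℂ)` (★ `ShimuraSetGS.eq_of_forall_mk_eq`),
points separate `ℂ`-morphisms, case split on `𝔻 = ∅`, and Prop. 13.1 (★ `GaloisDescent.existsUnique_map_eq_complex`).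

## References
* [Milne2005ShimuraVarieties] J. S. Milne, *Introduction to Shimura varieties* (2005; held rev. 2017
  `paper:url-b0e8e4ca1c12`), Prop. 13.1 p. 117, Lemma 13.5, Thm. 13.6 p. 118, Thm. 13.7 / Rem. 13.8 p. 119, (62) p. 114.
* [Deligne1979ShimuraVarieties] P. Deligne, *Variétés de Shimura* (1979), 2.2.4–2.2.6, Cor. 2.7.21.
* [Liu2021] Y. Liu, Camb. J. Math. 9 (2021), proof of Thm. 4.15 (FJcycle.tex l. 2193–2208).
-/

set_option autoImplicit false

noncomputable section

open Function MulAction Topology NumberField IsDedekindDomain CategoryTheory CategoryTheory.Limits Matrix AlgebraicGeometry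
open Cardinal
open scoped Matrix ComplexOrder
open Literature.AlgebraicGeometry.Motives Literature.NumberTheory.Automorphic Literature.NumberTheory.Automorphic.UnitaryGroup
open Literature.NumberTheory.Automorphic.Liu2021.AppendixC (C5.OpenCompactSubgroup C5.SmallLevel)
open Literature.Geometry.ComplexHyperbolic Literature.Geometry.ComplexHyperbolic.BallModel

namespace Literature.AlgebraicGeometry.ShimuraVarieties.UnitaryCanonicalModel

variable {L : Type} [Field L] [NumberField L] [IsCMField L] {Jstar : Matrix (Fin 2) (Fin 2) L} {τ : L →+* ℂ}
  {K₀ : C5.OpenCompactSubgroup ↥(finAdelic (↥(maximalRealSubfield L)) L (IsCMField.complexConj L) 2 Jstar)}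
  {H : Matrix (Fin 3) (Fin 3) L} {T : GL (Fin 3) ℂ} {hT : formCongr (starRingEnd ℂ) T (H.map τ) = BallModel.J}
  {K₀' : C5.OpenCompactSubgroup ↥(finAdelic (↥(maximalRealSubfield L)) L (IsCMField.complexConj L) 3 H)}

/-! ### §1. The image of a special point of the curve is the special point of the `L`-line of `B·(w ⊕ 0)` -/

section SpecialPoint

variable (τ) (B : GL (Fin 3) L)

omit [NumberField L] [IsCMField L] in
/-- `B^τ(τw ⊕ 0) = τ(B·(w ⊕ 0))`: the frame embedding of an `L`-RATIONAL vector is `L`-rational (plumbing). [folklore] -/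
private theorem frameEmbNeg_embedding (w : Fin 2 → L) :
    frameEmbNeg τ B (fun i => τ (w i)) = fun i => τ (((B : Matrix (Fin 3) (Fin 3) L) *ᵥ Fin.append w (0 : Fin 1 → L)) i) := by
  have happ : (fun i => τ (Fin.append w (0 : Fin 1 → L) i)) = Fin.append (fun i => τ (w i)) (0 : Fin 1 → ℂ) := by
    funext i
    refine Fin.addCases (fun j => ?_) (fun j => ?_) i
    · simp only [Fin.append_left]
    · simp only [Fin.append_right, Pi.zero_apply, map_zero]
  funext i
  rw [RingHom.map_mulVec]
  unfold frameEmbNeg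
  congr 1
  exact happ.symm

variable {τ B} {Jperp : Matrix (Fin 1) (Fin 1) L} {a : L} (ha : a ≠ 0)
  (hB : formCongr ((IsCMField.complexConj L : L ≃ₐ[↥(maximalRealSubfield L)] L) : L →+* L) B (a • H) = finSum 2 1 Jstar Jperp)
  (hτa : 0 < (τ a).re) (hτa' : (τ a).im = 0)

include hB hτa hτa' in
/-- The `L`-vector `B·(w ⊕ 0)` is negative at `τ` when `w` is (★ `frameEmbNeg_mem_negCone`). [cite: Milne2005ShimuraVarieties, Def. 12.5 p. 113] -/
theorem embedding_frame_append_mem_negCone {w : Fin 2 → L} (hw : (fun i => τ (w i)) ∈ negCone (Jstar.map τ)) :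
    (fun i => τ (((B : Matrix (Fin 3) (Fin 3) L) *ᵥ Fin.append w (0 : Fin 1 → L)) i)) ∈ negCone (H.map τ) := by
  rw [← frameEmbNeg_embedding τ B w]
  exact frameEmbNeg_mem_negCone τ hB hτa hτa' hw

/-- **`embPoints [τw, uK⋆] = [x₀, φGS(u)K]`** for the special point `x₀ ∈ 𝔹²` of the `L`-line of `v₃ = B·(w ⊕ 0)` (★
`IsLinePoint`): the image of a special point of the curve is a DIAGONAL special point of the surface — so the target's
reciprocity field applies to it. [cite: Milne2005ShimuraVarieties, Def. 12.5 p. 113 and Rem. 13.8 p. 119] -/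
theorem embPoints_mk_of_isLinePoint (Kstar : Subgroup ↥(finAdelic (↥(maximalRealSubfield L)) L (IsCMField.complexConj L) 2 Jstar))
    (K : Subgroup ↥(finAdelic (↥(maximalRealSubfield L)) L (IsCMField.complexConj L) 3 H))
    (hK : Kstar.map (φGS L Jstar Jperp H B ha hB) ≤ K) {w : Fin 2 → L} (hw : (fun i => τ (w i)) ∈ negCone (Jstar.map τ))
    {x₀ : Ball} (hx₀ : IsLinePoint L τ T ((B : Matrix (Fin 3) (Fin 3) L) *ᵥ Fin.append w (0 : Fin 1 → L)) x₀)
    (u : ↥(finAdelic (↥(maximalRealSubfield L)) L (IsCMField.complexConj L) 2 Jstar)) :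
    ShimuraSetGS.embPoints L H τ T hT Jstar Jperp B ha hB hτa hτa' Kstar K hK
        (ShimuraSetGS.mk L Jstar τ Kstar (fun i => τ (w i)) hw u) =
      ShimuraSet.mk L H τ T hT K x₀ (φGS L Jstar Jperp H B ha hB u) := by
  obtain ⟨c, hc, hx⟩ := hx₀
  refine ShimuraSetGS.embPoints_mk_of_eq_smul_frame_lift L H τ T hT Jstar Jperp B ha hB hτa hτa' Kstar K hK _ hw u x₀
    (inv_ne_zero hc) ?_
  rw [frameEmbNeg_embedding τ B w, hx, smul_smul, inv_mul_cancel₀ hc, one_smul]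

end SpecialPoint

/-! ### §2. Descent of a complex embedding -/

section Thm137

variable (Sstar : RecordSystemGS L Jstar τ K₀) (S : RecordSystem L H τ T hT K₀')
  (Jperp : Matrix (Fin 1) (Fin 1) L) (B : GL (Fin 3) L) {a : L} (ha : a ≠ 0)
  (hB : formCongr ((IsCMField.complexConj L : L ≃ₐ[↥(maximalRealSubfield L)] L) : L →+* L) B (a • H) = finSum 2 1 Jstar Jperp)
  (hτa : 0 < (τ a).re) (hτa' : (τ a).im = 0)
  (Kstar : C5.SmallLevel K₀) (K : C5.SmallLevel K₀') (hK : Kstar.1.1.map (φGS L Jstar Jperp H B ha hB) ≤ K.1.1)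
  (ιc : (Motives.baseChangeHom τ).obj (Sstar.M.obj Kstar) ⟶ (Motives.baseChangeHom τ).obj (S.M.obj K))
  (hιc : letI : Algebra L ℂ := τ.toAlgebra
    ∀ P : ShimuraSetGS L Jstar τ Kstar.1.1,
      AlgPoints.map ιc (AlgPoints.baseChangeEquiv τ (Sstar.M.obj Kstar) ((Sstar.pts Kstar).symm P)) =
        AlgPoints.baseChangeEquiv τ (S.M.obj K)
          ((S.pts K).symm (ShimuraSetGS.embPoints L H τ T hT Jstar Jperp B ha hB hτa hτa' Kstar.1.1 K.1.1 hK P)))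
  (t : letI : Algebra L ℂ := τ.toAlgebra; GaloisDescent.bc ℂ (Sstar.M.obj Kstar) ⟶ GaloisDescent.bc ℂ (S.M.obj K))
  (ht : letI : Algebra L ℂ := τ.toAlgebra; t = ιc.left)

include hιc ht in
/-- «`ι_ℂ` acts as `embPoints`» on underlying morphisms: `(P, 1) ≫ ι_ℂ = (embPoints P, 1)`. [cite: Liu2021, Thm. 4.15 proof (FJcycle.tex l. 2193)] -/
theorem RecordSystemGS.lift_comp_embComplex_left (P : ShimuraSetGS L Jstar τ Kstar.1.1) :
    letI : Algebra L ℂ := τ.toAlgebra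
    pullback.lift ((Sstar.pts Kstar).symm P).toSpecHom (𝟙 (Spec (.of ℂ)))
        (toSpecHom_comp_hom_eq (τ := τ) (Sstar.M.obj Kstar) _) ≫ t =
      pullback.lift ((S.pts K).symm (ShimuraSetGS.embPoints L H τ T hT Jstar Jperp B ha hB hτa hτa' Kstar.1.1 K.1.1 hK
          P)).toSpecHom (𝟙 (Spec (.of ℂ))) (toSpecHom_comp_hom_eq (τ := τ) (S.M.obj K) _) := by
  letI : Algebra L ℂ := τ.toAlgebra
  have h : (AlgPoints.baseChangeEquiv τ (Sstar.M.obj Kstar) ((Sstar.pts Kstar).symm P)).left ≫ ιc.left =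
      (AlgPoints.baseChangeEquiv τ (S.M.obj K) ((S.pts K).symm
        (ShimuraSetGS.embPoints L H τ T hT Jstar Jperp B ha hB hτa hτa' Kstar.1.1 K.1.1 hK P))).left :=
    congrArg (·.left) (hιc P)
  rw [← lift_eq_baseChangeEquiv_left, ← lift_eq_baseChangeEquiv_left, ← ht] at h
  exact h

set_option maxHeartbeats 800000 in -- large adelic / Shimura-set terms: instance-heavy statements (as the rank-3 file)
include hιc ht in
/-- **The conjugate `σ⁻¹(ι_ℂ)` agrees with `ι_ℂ` on the Hecke orbit of a special point** of the SOURCE (the square of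
[Milne2005ShimuraVarieties] p. 118 L33–39 for the embedding): for `σ ∈ Aut(ℂ/τL)`, Artin correspondents `s`, `s'` (for
`σ`, `σ⁻¹`), source twists `d⋆ = r_{x⋆}(s)`, `d⋆' = r_{x⋆}(s')` at `x⋆ = [τ w]`, the image special point `x₀` of the
`L`-line of `B·(w ⊕ 0)`, and ANY `T'` with underlying morphism `(1 × Spec σ) ≫ ι_ℂ ≫ (1 × Spec σ⁻¹)`: `T'(P) = ι_ℂ(P)` for
`P = pts⋆⁻¹[x⋆, uK⋆]` — the source's `recip` moves `P`, the target's `recip` AT THE TRANSPORTED TWISTS `φGS(d⋆)`, `φGS(d⋆')`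
(★ `isDiagTwist_φGS_of_isDiagTwistGS`) moves the images back. [cite: Milne2005ShimuraVarieties, Thm. 13.6 p. 118 L29–39; (62) p. 114; Rem. 13.8 p. 119] -/
theorem RecordSystemGS.map_conj_eq_embComplex_of_recip (σ : letI : Algebra L ℂ := τ.toAlgebra; ℂ ≃ₐ[L] ℂ)
    {w : Fin 2 → L} (hw : (fun i => τ (w i)) ∈ negCone (Jstar.map τ))
    {x₀ : Ball} (hx₀ : IsLinePoint L τ T ((B : Matrix (Fin 3) (Fin 3) L) *ᵥ Fin.append w (0 : Fin 1 → L)) x₀)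
    {s s' : (FiniteAdeleRing (𝓞 L) L)ˣ}
    (hs : letI : Algebra L ℂ := τ.toAlgebra; IsArtinCorrespondent L τ s σ.toRingEquiv)
    (hs' : letI : Algebra L ℂ := τ.toAlgebra; IsArtinCorrespondent L τ s' σ⁻¹.toRingEquiv)
    {dstar dstar' : ↥(finAdelic (↥(maximalRealSubfield L)) L (IsCMField.complexConj L) 2 Jstar)}
    (hd : IsDiagTwistGS L Jstar w (recipFactor L s) dstar) (hd' : IsDiagTwistGS L Jstar w (recipFactor L s') dstar')
    (T' : (Motives.baseChangeHom τ).obj (Sstar.M.obj Kstar) ⟶ (Motives.baseChangeHom τ).obj (S.M.obj K))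
    (hT' : letI : Algebra L ℂ := τ.toAlgebra
      GaloisDescent.gal ℂ (Sstar.M.obj Kstar) σ⁻¹ ≫ t ≫ GaloisDescent.gal ℂ (S.M.obj K) σ = T'.left)
    (u : ↥(finAdelic (↥(maximalRealSubfield L)) L (IsCMField.complexConj L) 2 Jstar)) :
    letI : Algebra L ℂ := τ.toAlgebra
    AlgPoints.map T' (AlgPoints.baseChangeEquiv τ (Sstar.M.obj Kstar)
        ((Sstar.pts Kstar).symm (ShimuraSetGS.mk L Jstar τ Kstar.1.1 (fun i => τ (w i)) hw u))) =
      AlgPoints.map ιc (AlgPoints.baseChangeEquiv τ (Sstar.M.obj Kstar)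
        ((Sstar.pts Kstar).symm (ShimuraSetGS.mk L Jstar τ Kstar.1.1 (fun i => τ (w i)) hw u))) := by
  letI : Algebra L ℂ := τ.toAlgebra
  -- the transported twists are twists of the image CM pair
  have hD := isDiagTwist_φGS_of_isDiagTwistGS L Jstar Jperp H B ha hB hd
  have hD' := isDiagTwist_φGS_of_isDiagTwistGS L Jstar Jperp H B ha hB hd'
  -- reciprocity: source at `σ⁻¹`, target at `σ` and `σ⁻¹`
  have rS : ∀ b, σ⁻¹ • (Sstar.pts Kstar).symm (ShimuraSetGS.mk L Jstar τ Kstar.1.1 (fun i => τ (w i)) hw b) =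
      (Sstar.pts Kstar).symm (ShimuraSetGS.mk L Jstar τ Kstar.1.1 (fun i => τ (w i)) hw (dstar' * b)) :=
    Sstar.recip Kstar σ⁻¹ s' hs' w hw dstar' hd'
  have rTσ : ∀ b, σ • (S.pts K).symm (ShimuraSet.mk L H τ T hT K.1.1 x₀ b) =
      (S.pts K).symm (ShimuraSet.mk L H τ T hT K.1.1 x₀ (φGS L Jstar Jperp H B ha hB dstar * b)) :=
    S.recip K σ s hs _ x₀ hx₀ _ hD
  have rT : ∀ b, σ⁻¹ • (S.pts K).symm (ShimuraSet.mk L H τ T hT K.1.1 x₀ b) =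
      (S.pts K).symm (ShimuraSet.mk L H τ T hT K.1.1 x₀ (φGS L Jstar Jperp H B ha hB dstar' * b)) :=
    S.recip K σ⁻¹ s' hs' _ x₀ hx₀ _ hD'
  -- `ι_ℂ` on the orbit: `(pts⋆⁻¹[x⋆, b], 1) ≫ ι_ℂ = (pts⁻¹[x₀, φGS(b)], 1)`
  have FT : ∀ b, pullback.lift ((Sstar.pts Kstar).symm (ShimuraSetGS.mk L Jstar τ Kstar.1.1 (fun i => τ (w i)) hw b)).toSpecHom
        (𝟙 (Spec (.of ℂ))) (toSpecHom_comp_hom_eq (τ := τ) (Sstar.M.obj Kstar) _) ≫ t =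
      pullback.lift ((S.pts K).symm (ShimuraSet.mk L H τ T hT K.1.1 x₀ (φGS L Jstar Jperp H B ha hB b))).toSpecHom
        (𝟙 (Spec (.of ℂ))) (toSpecHom_comp_hom_eq (τ := τ) (S.M.obj K) _) := by
    intro b
    have h := Sstar.lift_comp_embComplex_left S Jperp B ha hB hτa hτa' Kstar K hK ιc hιc t ht
      (ShimuraSetGS.mk L Jstar τ Kstar.1.1 (fun i => τ (w i)) hw b)
    rw [embPoints_mk_of_isLinePoint ha hB hτa hτa' Kstar.1.1 K.1.1 hK hw hx₀ b] at h
    exact h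
  set P := (Sstar.pts Kstar).symm (ShimuraSetGS.mk L Jstar τ Kstar.1.1 (fun i => τ (w i)) hw u) with hP
  apply Over.OverMorphism.ext
  change (AlgPoints.baseChangeEquiv τ (Sstar.M.obj Kstar) P).left ≫ T'.left =
    (AlgPoints.baseChangeEquiv τ (Sstar.M.obj Kstar) P).left ≫ ιc.left
  rw [← lift_eq_baseChangeEquiv_left, ← hT', ← ht]
  change pullback.lift P.toSpecHom (𝟙 (Spec (.of ℂ))) (toSpecHom_comp_hom_eq (τ := τ) (Sstar.M.obj Kstar) P) ≫
      (GaloisDescent.gal ℂ (Sstar.M.obj Kstar) σ⁻¹ ≫ t ≫ GaloisDescent.gal ℂ (S.M.obj K) σ) =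
    pullback.lift P.toSpecHom (𝟙 (Spec (.of ℂ))) (toSpecHom_comp_hom_eq (τ := τ) (Sstar.M.obj Kstar) P) ≫ t
  -- move the point through `gal σ⁻¹` (source recip), apply `ι_ℂ`, move through `gal σ` (target recip)
  have step1 : pullback.lift P.toSpecHom (𝟙 (Spec (.of ℂ))) (toSpecHom_comp_hom_eq (τ := τ) (Sstar.M.obj Kstar) P) ≫
      GaloisDescent.gal ℂ (Sstar.M.obj Kstar) σ⁻¹ =
      AbelianVariety.specAut ℂ σ ≫ pullback.lift (σ⁻¹ • P).toSpecHom (𝟙 (Spec (.of ℂ)))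
        (toSpecHom_comp_hom_eq (τ := τ) (Sstar.M.obj Kstar) (σ⁻¹ • P)) := by
    have h := lift_comp_gal (τ := τ) (Sstar.M.obj Kstar) σ⁻¹ P
    rw [inv_inv] at h
    exact h
  rw [← Category.assoc, step1, Category.assoc, hP, rS u, ← Category.assoc (pullback.lift _ _ _), FT (dstar' * u),
    lift_comp_gal (τ := τ) (S.M.obj K) σ, rTσ, ← Category.assoc, AbelianVariety.specAut_comp_specAut_symm,
    Category.id_comp, FT u]
  -- the two points of `M_K(ℂ)` coincide: `[x₀, φ(d⋆) φ(d⋆') φ(u) K] = [x₀, φ(u) K]`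
  have hfix : (S.pts K).symm (ShimuraSet.mk L H τ T hT K.1.1 x₀
      (φGS L Jstar Jperp H B ha hB dstar * φGS L Jstar Jperp H B ha hB (dstar' * u))) =
      (S.pts K).symm (ShimuraSet.mk L H τ T hT K.1.1 x₀ (φGS L Jstar Jperp H B ha hB u)) := by
    rw [map_mul, ← rTσ, ← rT, smul_inv_smul]
  rw [hfix]

set_option maxHeartbeats 400000 in -- large adelic / Shimura-set terms: instance-heavy statements (as the rank-3 file)
include hιc ht in
/-- **`σ(ι_ℂ) = ι_ℂ`**: a `ℂ`-morphism of the complex fibres acting as ★ `embPoints` commutes with `1 × Spec σ⁻¹`,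
`σ ∈ Aut(ℂ/τL)` — the conjugate `T'` is a `ℂ`-morphism; `ℂ`-morphisms out of the (reduced) source fibre are determined
by their complex points, read through `e : (M⋆_{K⋆})_τ(ℂ) ≃ₜ Sh_{K⋆}(ℂ)`; CASE SPLIT: if `𝔻 ≠ ∅`, a special point `[τw]`
(`exists_embedding_mem_negCone`), agreement on its Hecke orbit (`map_conj_eq_embComplex_of_recip`), density (★
`ShimuraSetGS.eq_of_forall_mk_eq`); if `𝔻 = ∅`, vacuous. [cite: Milne2005ShimuraVarieties, Thm. 13.6 p. 118 L29–41; Lemma 13.5; Rem. 13.8 p. 119] -/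
theorem RecordSystemGS.gal_comp_embComplex (hJ : (Jstar.map (IsCMField.complexConj L))ᵀ = Jstar) (hdet : IsUnit Jstar.det)
    (σ : letI : Algebra L ℂ := τ.toAlgebra; ℂ ≃ₐ[L] ℂ)
    (e : letI : Algebra L ℂ := τ.toAlgebra
      ComplexPoints ((Motives.baseChangeHom τ).obj (Sstar.M.obj Kstar)) ≃ₜ ShimuraSetGS L Jstar τ Kstar.1.1)
    (he : letI : Algebra L ℂ := τ.toAlgebra
      ∀ (v : Fin 2 → ℂ) (hv : v ∈ negCone (Jstar.map τ))
        (b : ↥(finAdelic (↥(maximalRealSubfield L)) L (IsCMField.complexConj L) 2 Jstar)),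
        e.symm (ShimuraSetGS.mk L Jstar τ Kstar.1.1 v hv b) =
          AlgPoints.baseChangeEquiv τ (Sstar.M.obj Kstar) ((Sstar.pts Kstar).symm (ShimuraSetGS.mk L Jstar τ Kstar.1.1 v hv b))) :
    letI : Algebra L ℂ := τ.toAlgebra
    GaloisDescent.gal ℂ (Sstar.M.obj Kstar) σ ≫ t = t ≫ GaloisDescent.gal ℂ (S.M.obj K) σ := by
  letI : Algebra L ℂ := τ.toAlgebra
  -- instances on the complex fibres
  haveI : SmoothOfRelativeDimension 1 ((Motives.baseChangeHom τ).obj (Sstar.M.obj Kstar)).hom :=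
    Sstar.smooth_complexFibre Kstar
  haveI : Smooth ((Motives.baseChangeHom τ).obj (Sstar.M.obj Kstar)).hom := SmoothOfRelativeDimension.smooth 1 _
  haveI : IsReduced ((Motives.baseChangeHom τ).obj (Sstar.M.obj Kstar)).left :=
    isReduced_of_smooth_over_field ((Motives.baseChangeHom τ).obj (Sstar.M.obj Kstar)).hom
  haveI : IsProper ((Motives.baseChangeHom τ).obj (S.M.obj K)).hom := (S.projective_complexFibre K).isProper
  haveI : T2Space (ComplexPoints ((Motives.baseChangeHom τ).obj (S.M.obj K))) := ComplexPoints.t2Space_of_isSeparated _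
  -- `ι_ℂ` is a morphism over `ℂ`
  have hTsnd : t ≫ pullback.snd (S.M.obj K).hom (AbelianVariety.bcSpec L ℂ) =
      pullback.snd (Sstar.M.obj Kstar).hom (AbelianVariety.bcSpec L ℂ) := by
    rw [ht]
    exact Over.w ιc
  -- the conjugate morphism `gal σ⁻¹ ≫ ι_ℂ ≫ gal σ`, a morphism OVER `ℂ`
  have hw : (GaloisDescent.gal ℂ (Sstar.M.obj Kstar) σ⁻¹ ≫ t ≫ GaloisDescent.gal ℂ (S.M.obj K) σ) ≫
      pullback.snd (S.M.obj K).hom (AbelianVariety.bcSpec L ℂ) =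
        pullback.snd (Sstar.M.obj Kstar).hom (AbelianVariety.bcSpec L ℂ) := by
    rw [Category.assoc, Category.assoc, GaloisDescent.gal_snd, ← Category.assoc t, hTsnd,
      GaloisDescent.gal_snd_assoc, inv_inv, AbelianVariety.specAut_comp_specAut_symm, Category.comp_id]
  let T' : (Motives.baseChangeHom τ).obj (Sstar.M.obj Kstar) ⟶ (Motives.baseChangeHom τ).obj (S.M.obj K) :=
    Over.homMk (GaloisDescent.gal ℂ (Sstar.M.obj Kstar) σ⁻¹ ≫ t ≫ GaloisDescent.gal ℂ (S.M.obj K) σ) hw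
  have hT' : GaloisDescent.gal ℂ (Sstar.M.obj Kstar) σ⁻¹ ≫ t ≫ GaloisDescent.gal ℂ (S.M.obj K) σ = T'.left := rfl
  -- `T' = ι_ℂ`: case split on the existence of a special point of the source
  have hT'T : T' = ιc := by
    by_cases hne : ∃ v : Fin 2 → ℂ, v ∈ negCone (Jstar.map τ)
    · obtain ⟨v, hv⟩ := hne
      obtain ⟨w, hw0⟩ := exists_embedding_mem_negCone Jstar τ hv
      have hww : hermForm (cmConjRingHom L) Jstar w w ≠ 0 := hermForm_self_ne_zero_of_embedding_mem_negCone hw0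
      -- the image special point `x₀` of the `L`-line of `B·(w ⊕ 0)`
      have hx := (exists_unique_isLinePoint L H τ T hT _ (embedding_frame_append_mem_negCone hB hτa hτa' hw0)).exists
      -- Artin data and source twists for `σ` and `σ⁻¹`
      refine (exists_finiteIdele_isArtinCorrespondent_algEquiv L τ σ).elim fun s hs => ?_
      refine (exists_finiteIdele_isArtinCorrespondent_algEquiv L τ σ⁻¹).elim fun s' hs' => ?_
      refine (exists_isDiagTwistGS_recipFactor' L Jstar hJ hww s).elim fun d hd => ?_
      refine (exists_isDiagTwistGS_recipFactor' L Jstar hJ hww s').elim fun d' hd' => ?_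
      -- `T'` and `ι_ℂ` agree on the Hecke orbit of `[τ w]`, hence everywhere (density, Lemma 13.5)
      have horbit : ∀ b : ↥(finAdelic (↥(maximalRealSubfield L)) L (IsCMField.complexConj L) 2 Jstar),
          AlgPoints.map T' (e.symm (ShimuraSetGS.mk L Jstar τ Kstar.1.1 (fun i => τ (w i)) hw0 b)) =
            AlgPoints.map ιc (e.symm (ShimuraSetGS.mk L Jstar τ Kstar.1.1 (fun i => τ (w i)) hw0 b)) := by
        intro b
        rw [he]
        exact Sstar.map_conj_eq_embComplex_of_recip S Jperp B ha hB hτa hτa' Kstar K hK ιc hιc t ht σ hw0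
          (Classical.choose_spec hx) hs hs' hd hd' T' hT' b
      have hfun : (fun p => AlgPoints.map T' (e.symm p)) = fun p => AlgPoints.map ιc (e.symm p) :=
        ShimuraSetGS.eq_of_forall_mk_eq L Jstar τ Kstar.1.1 hJ hdet hw0
          ((AlgPoints.continuous_map T').comp e.symm.continuous)
          ((AlgPoints.continuous_map ιc).comp e.symm.continuous) horbit
      refine SchemeOver.hom_ext_of_forall_algPoints ℂ fun P => ?_
      have h := congrFun hfun (e P)
      simp only [Homeomorph.symm_apply_apply, AlgPoints.map_apply] at h
      exact h
    · -- no special point: `Sh_{K⋆}(ℂ) = ∅`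
      refine SchemeOver.hom_ext_of_forall_algPoints ℂ fun P => ?_
      obtain ⟨v, hv, b, -⟩ := ShimuraSetGS.mk_surjective L Jstar τ Kstar.1.1 (e P)
      exact absurd ⟨v, hv⟩ hne
  -- unwind: `gal σ⁻¹ ≫ t ≫ gal σ = t`
  have hconj : GaloisDescent.gal ℂ (Sstar.M.obj Kstar) σ⁻¹ ≫ t ≫ GaloisDescent.gal ℂ (S.M.obj K) σ = t := by
    have h := congrArg (·.left) hT'T
    rw [← hT', ← ht] at h
    exact h
  have h := congrArg (GaloisDescent.gal ℂ (Sstar.M.obj Kstar) σ ≫ ·) hconj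
  simp only [GaloisDescent.gal_comp_gal_symm_assoc] at h
  exact h.symm

omit t ht

set_option maxHeartbeats 400000 in -- large adelic / Shimura-set terms: instance-heavy statements (as the rank-3 file)
include hιc in
/-- **[Deligne1979] 2.2.6 / [Milne2005ShimuraVarieties] Thm. 13.7–Rem. 13.8 for the sub-datum `U(J⋆) ↪ U(H)`, by the printed
Prop.-13.1 argument**: for the curve record system `S⋆`, the rank-3 record system `S`, a frame `ᵗ(cB)·(a·H)·B = J⋆ ⊕ J⊥`
(`τa` a positive real), `J⋆` non-degenerate `c`-hermitian, and levels with `φGS(K⋆) ≤ K`: if SOME `ℂ`-morphism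
`ι_ℂ : (M⋆_{K⋆})_τ → (M_K)_τ` acts on complex points as ★ `ShimuraSetGS.embPoints`, then ★
`S⋆.IsEmbedding S … K⋆ K hK ι` holds for some `L`-morphism `ι` — `ι_ℂ` is `Aut(ℂ/τL)`-equivariant
(`gal_comp_embComplex`) and descends by Prop. 13.1 (★ `GaloisDescent.existsUnique_map_eq_complex`).
[cite: Deligne1979ShimuraVarieties, 2.2.6 and Cor. 2.7.21] [cite: Milne2005ShimuraVarieties, Thm. 13.7 and Rem. 13.8 p. 119; Prop. 13.1 p. 117] -/
theorem RecordSystemGS.exists_embedding_of_complex (hJ : (Jstar.map (IsCMField.complexConj L))ᵀ = Jstar)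
    (hdet : IsUnit Jstar.det) : ∃ ι : Sstar.M.obj Kstar ⟶ S.M.obj K, Sstar.IsEmbedding S Jperp B ha hB hτa hτa' Kstar K hK ι := by
  letI : Algebra L ℂ := τ.toAlgebra
  -- instances
  haveI : SmoothOfRelativeDimension 1 ((Motives.baseChangeHom τ).obj (Sstar.M.obj Kstar)).hom :=
    Sstar.smooth_complexFibre Kstar
  haveI : Smooth ((Motives.baseChangeHom τ).obj (Sstar.M.obj Kstar)).hom := SmoothOfRelativeDimension.smooth 1 _
  haveI hXred : IsReduced ((Motives.baseChangeHom τ).obj (Sstar.M.obj Kstar)).left :=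
    isReduced_of_smooth_over_field ((Motives.baseChangeHom τ).obj (Sstar.M.obj Kstar)).hom
  haveI : IsReduced (GaloisDescent.bc ℂ (Sstar.M.obj Kstar)) := hXred
  haveI : IsProper (S.M.obj K).hom := (S.projective K).isProper
  -- the homeomorphism of the source record's normalisation
  obtain ⟨eK, heK⟩ := Sstar.exists_homeomorph_complexFibre Kstar
  -- equivariance, for every `σ`
  have hequiv : ∀ σ : ℂ ≃ₐ[L] ℂ, GaloisDescent.gal ℂ (Sstar.M.obj Kstar) σ ≫ ιc.left =
      ιc.left ≫ GaloisDescent.gal ℂ (S.M.obj K) σ := fun σ =>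
    Sstar.gal_comp_embComplex S Jperp B ha hB hτa hτa' Kstar K hK ιc hιc ιc.left rfl hJ hdet σ eK heK
  -- DESCENT (Prop. 13.1)
  have hL : #L ≤ ℵ₀ := by
    refine (Algebra.IsAlgebraic.cardinalMk_le_max ℚ L).trans ?_
    rw [Cardinal.mkRat, max_self]
  refine (GaloisDescent.existsUnique_map_eq_complex (K := L) (X := Sstar.M.obj Kstar) (Y := S.M.obj K) hL ιc
    (fun σ => hequiv σ)).exists.elim fun f hf => ?_
  refine ⟨f, fun P => ?_⟩
  -- POINTS: `f` acts as `embPoints`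
  suffices hmap : AlgPoints.map f ((Sstar.pts Kstar).symm P) =
      (S.pts K).symm (ShimuraSetGS.embPoints L H τ T hT Jstar Jperp B ha hB hτa hτa' Kstar.1.1 K.1.1 hK P) by
    rw [hmap, Homeomorph.apply_symm_apply]
  apply eq_of_lift_eq (τ := τ) (S.M.obj K)
  rw [← Sstar.lift_comp_embComplex_left S Jperp B ha hB hτa hτa' Kstar K hK ιc hιc ιc.left rfl P]
  -- the base change of `f` on the fibre product: `(pr₁ ≫ f, pr₂)`
  have hfl : ((AbelianVariety.bcFunctor L ℂ).map f).left =
      pullback.lift (pullback.fst (Sstar.M.obj Kstar).hom (AbelianVariety.bcSpec L ℂ) ≫ f.left)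
        (pullback.snd (Sstar.M.obj Kstar).hom (AbelianVariety.bcSpec L ℂ))
        (by rw [Category.assoc, Over.w f]; exact pullback.condition) :=
    Over.pullback_map_left _ _
  have key : (pullback.lift ((Sstar.pts Kstar).symm P).toSpecHom (𝟙 (Spec (.of ℂ)))
        (toSpecHom_comp_hom_eq (τ := τ) (Sstar.M.obj Kstar) _) ≫ ιc.left :
        Spec (.of ℂ) ⟶ GaloisDescent.bc ℂ (S.M.obj K)) =
      pullback.lift ((Sstar.pts Kstar).symm P).toSpecHom (𝟙 (Spec (.of ℂ)))
        (toSpecHom_comp_hom_eq (τ := τ) (Sstar.M.obj Kstar) _) ≫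
      pullback.lift (pullback.fst (Sstar.M.obj Kstar).hom (AbelianVariety.bcSpec L ℂ) ≫ f.left)
        (pullback.snd (Sstar.M.obj Kstar).hom (AbelianVariety.bcSpec L ℂ))
        (by rw [Category.assoc, Over.w f]; exact pullback.condition) := by
    rw [← hfl, ← hf]
  rw [key]
  apply pullback.hom_ext
  · simp only [Category.assoc, pullback.lift_fst, pullback.lift_fst_assoc]
    rfl
  · simp only [Category.assoc, pullback.lift_snd]

end Thm137

/-! ### §3. The reduction: u2 `EmbeddingDefinedOver` ⇐ «the embedding is a morphism over `ℂ`» -/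

/-- **u2 of the GS-3 cluster follows from its complex half**: if for all levels `K⋆ ≤ K₀⋆`, `K ≤ K₀` with `φGS(K⋆) ≤ K`
some `ℂ`-morphism of the complex fibres acts as ★ `ShimuraSetGS.embPoints` on complex points, then ★
`S⋆.EmbeddingDefinedOver S J⊥ B ha hB hτa hτa'` (the conjunct u2 of ★ `exists_recordSystemGS`, text of record); what u2
still owes is ONLY that complex half (the holomorphic map of compact disc quotients into compact ball quotients is
algebraic — GAGA). [cite: Deligne1979ShimuraVarieties, 2.2.6 and Cor. 2.7.21] [cite: Milne2005ShimuraVarieties, Thm. 13.7 and Rem. 13.8 p. 119] -/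
theorem RecordSystemGS.embeddingDefinedOver_of_complex (Sstar : RecordSystemGS L Jstar τ K₀) (S : RecordSystem L H τ T hT K₀')
    (Jperp : Matrix (Fin 1) (Fin 1) L) (B : GL (Fin 3) L) {a : L} (ha : a ≠ 0)
    (hB : formCongr ((IsCMField.complexConj L : L ≃ₐ[↥(maximalRealSubfield L)] L) : L →+* L) B (a • H) = finSum 2 1 Jstar Jperp)
    (hτa : 0 < (τ a).re) (hτa' : (τ a).im = 0) (hJ : (Jstar.map (IsCMField.complexConj L))ᵀ = Jstar)
    (hdet : IsUnit Jstar.det)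
    (hC : letI : Algebra L ℂ := τ.toAlgebra
      ∀ (Kstar : C5.SmallLevel K₀) (K : C5.SmallLevel K₀') (hK : Kstar.1.1.map (φGS L Jstar Jperp H B ha hB) ≤ K.1.1),
        ∃ ιc : (Motives.baseChangeHom τ).obj (Sstar.M.obj Kstar) ⟶ (Motives.baseChangeHom τ).obj (S.M.obj K),
          ∀ P : ShimuraSetGS L Jstar τ Kstar.1.1,
            AlgPoints.map ιc (AlgPoints.baseChangeEquiv τ (Sstar.M.obj Kstar) ((Sstar.pts Kstar).symm P)) =
              AlgPoints.baseChangeEquiv τ (S.M.obj K)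
                ((S.pts K).symm (ShimuraSetGS.embPoints L H τ T hT Jstar Jperp B ha hB hτa hτa' Kstar.1.1 K.1.1 hK P))) :
    Sstar.EmbeddingDefinedOver S Jperp B ha hB hτa hτa' := by
  intro Kstar K hK
  obtain ⟨ιc, hιc⟩ := hC Kstar K hK
  exact Sstar.exists_embedding_of_complex S Jperp B ha hB hτa hτa' Kstar K hK ιc hιc hJ hdet

end Literature.AlgebraicGeometry.ShimuraVarieties.UnitaryCanonicalModel

end
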